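import Summits.Parity.GeneralizedHardyLittlewood.Theorems.GreenTaoLevelTwoMNTwoPropNineteenOfInverse
import Summits.Parity.GeneralizedHardyLittlewood.Theorems.GreenTaoLevelTwoMNTwoDichotomy
import Summits.Parity.GeneralizedHardyLittlewood.Theorems.GreenTaoLevelTwoMNTwoDichotomyThresholds

/-!
# Route `GreenTaoLevelTwo`, crux `MNTwo` (stmt-Parity-21276), line `birth`, stub `stub_mnVertical`:
# Proposition 22 at the budget scale from its type I / type II halves (GT 2008b §10, assembly)

Block H4 (assembly) of the `stub_mnVertical` census (B. Green, T. Tao, *Quadratic uniformity of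
the Möbius function*, Ann. Inst. Fourier 58 (2008) = arXiv:math/0606087, §10: "We now apply
Proposition 9 with `f(n) := ψ(n)e(φ(n))` and `U = V = N^{1/3}` to conclude one of the following
statements must be true: (Type I sum is large) … (Type II sum is large) …").  Def-free.  The
remaining target of the stub is "Prop. 22 at the budget scale"
(`…MNTwoInverseOfPropTwentyTwo.majorArcInverse_largeN_of_prop22`, hypothesis `h22`).  This file
performs the §10 set-up once and for all — rescaling the weight to `ψ/2 ≤ 1`, conjugating the sum
(`e(−φ) ↦ e(φ)`), lifting the phase to `ℝ/ℤ`, choosing `u = ⌊⌊N^{1/2}⌋^{1/2}⌋`, `X = N/(8 log^A N)`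
and the levels `η₁ = η₂ = 10⁻⁸ log^{-(2A+5)} N`, verifying the polylogarithmic thresholds of
`…MNTwoDichotomy.dichotomy` for `N ≥ N₁(A)`, and applying the dichotomy — and thereby reduces
`h22` to its two halves AT THE BUDGET SCALE, stated for an `ℝ/ℤ`-valued phase and a `[0,1]`-valued
weight in the gauge vocabulary of `…MNTwoTypeIMajorArc` / `…MNTwoTypeIBranch`:

* `hI`  — the type I half: the type I alternative of `dichotomy` (level `η ≥ c·log^{-a} N`,
  `d ≤ U`, `U² ≤ N`) implies the Prop-22 clause set at `ρ₁ = P^{-(k+2)(4+4^{k+2})}`,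
  `P = log^{A₀} N`, for every `A₀ ≥ A₂(a,c)` and `N ≥ N₂(A₀)` (to be discharged from
  `…MNTwoTypeIBranch.prop22_of_typeI`, Lemma 23);
* `hII` — the type II half: the same from the type II alternative (level `η`, `u ≤ K`, `Ku ≤ 2N`,
  `N < (u+1)⁴`) (to be discharged from Lemma 24 via `…MNTwoTypeIIBranch.prop22_of_typeII_core`).

* `prop22_budget_of_branches` — `hI → hII → h22` (the corollary for the stub itself is in
  `…MNTwoVerticalOfBranches`).

References: [GreenTao2008QuadraticMobius] arXiv:math/0606087 §10 (Prop. 22 and its proof).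
-/

noncomputable section

open Finset Real ArithmeticFunction Filter Asymptotics
open scoped ArithmeticFunction.Moebius FourierTransform ComplexConjugate

namespace Summit.Parity.GeneralizedHardyLittlewood.GreenTaoLevelTwoMNTwoPropTwentyTwoBudget

open Summit.Parity.GeneralizedHardyLittlewood.GreenTaoLevelTwoMNTwoDichotomy (dichotomy)
open Summit.Parity.GeneralizedHardyLittlewood.GreenTaoLevelTwoMNTwoPropNineteenGlue
  (cube_vanish_of_integral)
open Summit.Parity.GeneralizedHardyLittlewood.GreenTaoLevelTwoMNTwoDichotomyThresholds
  (norm_sum_half_weight dichotomy_thresholds)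
open Summit.Parity.GeneralizedHardyLittlewood.GreenTaoLevelTwoMNTwoPropNineteenOfInverse
  (weight_le_three_halves)
open Summit.Parity.GeneralizedHardyLittlewood.GreenTaoLevelTwoMNTwoBohrGauge
  (bddAbove_range_norm iSup_norm_nonneg bohrGauge_lt_iff)

variable {k : ℕ}

/-- **Proposition 22 at the budget scale from its two halves (GT 2008b §10).**  See the module
docstring for `hI` (type I half, Lemma 23 side) and `hII` (type II half, Lemma 24 side); the
conclusion is the hypothesis `h22` of
`…MNTwoInverseOfPropTwentyTwo.majorArcInverse_largeN_of_prop22 k` verbatim.  Proof: given `A`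
and the floor `A₁`, take `a = 2A + 5`, `c = 10⁻⁸`, `A₀ = max(A₁, A₂ᴵ, A₂ᴵᴵ)`,
`N₀ = max(N₁(A), N₂ᴵ, N₂ᴵᴵ)`; rescale `ψ ↦ ψ/2`, lift `φ` to `ℝ/ℤ`, conjugate the sum, and apply
`…MNTwoDichotomy.dichotomy` with `u = ⌊√⌊√N⌋⌋`, `X = N/(8 log^A N)`,
`η₁ = η₂ = 10⁻⁸ log^{-(2A+5)} N`. [cite: GreenTao2008QuadraticMobius, §10 (proof of Prop. 22)] -/
theorem prop22_budget_of_branches (k : ℕ)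
    (hI : ∀ (aη cη : ℝ), 0 < aη → 0 < cη → ∃ A₂ : ℝ, ∀ A₀ : ℝ, A₂ ≤ A₀ →
      ∃ N₂ : ℕ, ∀ N : ℕ, N₂ ≤ N → 2 ≤ N →
      ∀ (α : Fin k → ℝ) (n₀ : ℤ) (ρ : ℝ), 0 < ρ → 100000 * ρ < 1 → (Real.log N ^ aη)⁻¹ ≤ ρ →
      ∀ (φ : ℤ → UnitAddCircle),
        (∀ n a b c : ℤ,
          (⨆ i : Fin k, ‖((((n - n₀ : ℤ) : ℝ) * α i : ℝ) : AddCircle (1 : ℝ))‖) +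
              |((n - n₀ : ℤ) : ℝ)| / N < 100 * ρ →
          (⨆ i : Fin k, ‖((((n + a - n₀ : ℤ) : ℝ) * α i : ℝ) : AddCircle (1 : ℝ))‖) +
              |((n + a - n₀ : ℤ) : ℝ)| / N < 100 * ρ →
          (⨆ i : Fin k, ‖((((n + b - n₀ : ℤ) : ℝ) * α i : ℝ) : AddCircle (1 : ℝ))‖) +
              |((n + b - n₀ : ℤ) : ℝ)| / N < 100 * ρ →
          (⨆ i : Fin k, ‖((((n + c - n₀ : ℤ) : ℝ) * α i : ℝ) : AddCircle (1 : ℝ))‖) +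
              |((n + c - n₀ : ℤ) : ℝ)| / N < 100 * ρ →
          (⨆ i : Fin k, ‖((((n + a + b - n₀ : ℤ) : ℝ) * α i : ℝ) : AddCircle (1 : ℝ))‖) +
              |((n + a + b - n₀ : ℤ) : ℝ)| / N < 100 * ρ →
          (⨆ i : Fin k, ‖((((n + a + c - n₀ : ℤ) : ℝ) * α i : ℝ) : AddCircle (1 : ℝ))‖) +
              |((n + a + c - n₀ : ℤ) : ℝ)| / N < 100 * ρ →
          (⨆ i : Fin k, ‖((((n + b + c - n₀ : ℤ) : ℝ) * α i : ℝ) : AddCircle (1 : ℝ))‖) +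
              |((n + b + c - n₀ : ℤ) : ℝ)| / N < 100 * ρ →
          (⨆ i : Fin k, ‖((((n + a + b + c - n₀ : ℤ) : ℝ) * α i : ℝ) : AddCircle (1 : ℝ))‖) +
              |((n + a + b + c - n₀ : ℤ) : ℝ)| / N < 100 * ρ →
          φ (n + a + b + c) - φ (n + a + b) - φ (n + a + c) - φ (n + b + c)
            + φ (n + a) + φ (n + b) + φ (n + c) - φ n = 0) →
      ∀ (ψ : ℤ → ℝ), (∀ n, 0 ≤ ψ n) → (∀ n, ψ n ≤ 1) →
        (∀ n, ψ n ≠ 0 →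
          (⨆ i : Fin k, ‖((((n - n₀ : ℤ) : ℝ) * α i : ℝ) : AddCircle (1 : ℝ))‖) +
            |((n - n₀ : ℤ) : ℝ)| / N < ρ) →
        (∀ n, ψ n ≠ 0 → (N : ℤ) < n ∧ n ≤ 2 * N) →
        (∀ n n' : ℤ, |ψ n - ψ n'| ≤
          (⨆ i : Fin k, ‖((((n - n' : ℤ) : ℝ) * α i : ℝ) : AddCircle (1 : ℝ))‖) +
            |((n - n' : ℤ) : ℝ)| / N) →
      ∀ (η : ℝ), cη * (Real.log N ^ aη)⁻¹ ≤ η → 2 * η ≤ 1 →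
      ∀ (U j : ℕ), U * U ≤ N →
        η ^ 2 * 2 ^ j ≤ #((Icc 1 U).filter fun d => Nat.log 2 d = j ∧
          η * ((2 * N : ℕ) : ℝ) / 2 ^ j ≤
            ‖∑ w ∈ Icc 1 (2 * N / d), ((ψ ((d * w : ℕ) : ℤ) : ℝ) : ℂ) *
              (AddCircle.toCircle (φ ((d * w : ℕ) : ℤ)) : ℂ)‖) →
      ∀ ρ₁ : ℝ, ρ₁ = ((Real.log N ^ A₀) ^ ((k + 2) * (4 + 4 ^ (k + 2))))⁻¹ →
        ∃ (D : ℕ) (𝒟 : Finset ℕ), 1 ≤ D ∧ 𝒟 ⊆ Icc 1 D ∧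
          4 * (32 * 38 ^ k) * (D : ℝ) ≤ (ρ₁ / 16) ^ (k + 1) * N / 2 ∧
          ρ₁ * (D : ℝ) ^ 2 / Real.log N ^ A₀ ≤ (#𝒟 : ℝ) ^ 2 ∧
          ∀ d ∈ 𝒟, ∀ n ∈ (Finset.Ioo (-(N : ℤ)) N).filter fun n : ℤ =>
              (∀ i, ‖(((n : ℝ) * α i : ℝ) : AddCircle (1 : ℝ))‖ + |(n : ℝ)| / N < ρ₁) ∧
                |(n : ℝ)| / N < ρ₁,
            (d : ℤ) ∣ n → ∃ q : ℕ, 1 ≤ q ∧ (q : ℝ) ≤ Real.log N ^ A₀ ∧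
              ‖((q : ℤ)) • (φ (n₀ + n + n) - φ (n₀ + n) - φ (n₀ + n) + φ n₀)‖ ≤
                Real.log N ^ A₀ * ρ₁ ^ 2)
    (hII : ∀ (aη cη : ℝ), 0 < aη → 0 < cη → ∃ A₂ : ℝ, ∀ A₀ : ℝ, A₂ ≤ A₀ →
      ∃ N₂ : ℕ, ∀ N : ℕ, N₂ ≤ N → 2 ≤ N →
      ∀ (α : Fin k → ℝ) (n₀ : ℤ) (ρ : ℝ), 0 < ρ → 100000 * ρ < 1 → (Real.log N ^ aη)⁻¹ ≤ ρ →
      ∀ (φ : ℤ → UnitAddCircle),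
        (∀ n a b c : ℤ,
          (⨆ i : Fin k, ‖((((n - n₀ : ℤ) : ℝ) * α i : ℝ) : AddCircle (1 : ℝ))‖) +
              |((n - n₀ : ℤ) : ℝ)| / N < 100 * ρ →
          (⨆ i : Fin k, ‖((((n + a - n₀ : ℤ) : ℝ) * α i : ℝ) : AddCircle (1 : ℝ))‖) +
              |((n + a - n₀ : ℤ) : ℝ)| / N < 100 * ρ →
          (⨆ i : Fin k, ‖((((n + b - n₀ : ℤ) : ℝ) * α i : ℝ) : AddCircle (1 : ℝ))‖) +
              |((n + b - n₀ : ℤ) : ℝ)| / N < 100 * ρ →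
          (⨆ i : Fin k, ‖((((n + c - n₀ : ℤ) : ℝ) * α i : ℝ) : AddCircle (1 : ℝ))‖) +
              |((n + c - n₀ : ℤ) : ℝ)| / N < 100 * ρ →
          (⨆ i : Fin k, ‖((((n + a + b - n₀ : ℤ) : ℝ) * α i : ℝ) : AddCircle (1 : ℝ))‖) +
              |((n + a + b - n₀ : ℤ) : ℝ)| / N < 100 * ρ →
          (⨆ i : Fin k, ‖((((n + a + c - n₀ : ℤ) : ℝ) * α i : ℝ) : AddCircle (1 : ℝ))‖) +
              |((n + a + c - n₀ : ℤ) : ℝ)| / N < 100 * ρ →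
          (⨆ i : Fin k, ‖((((n + b + c - n₀ : ℤ) : ℝ) * α i : ℝ) : AddCircle (1 : ℝ))‖) +
              |((n + b + c - n₀ : ℤ) : ℝ)| / N < 100 * ρ →
          (⨆ i : Fin k, ‖((((n + a + b + c - n₀ : ℤ) : ℝ) * α i : ℝ) : AddCircle (1 : ℝ))‖) +
              |((n + a + b + c - n₀ : ℤ) : ℝ)| / N < 100 * ρ →
          φ (n + a + b + c) - φ (n + a + b) - φ (n + a + c) - φ (n + b + c)
            + φ (n + a) + φ (n + b) + φ (n + c) - φ n = 0) →
      ∀ (ψ : ℤ → ℝ), (∀ n, 0 ≤ ψ n) → (∀ n, ψ n ≤ 1) →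
        (∀ n, ψ n ≠ 0 →
          (⨆ i : Fin k, ‖((((n - n₀ : ℤ) : ℝ) * α i : ℝ) : AddCircle (1 : ℝ))‖) +
            |((n - n₀ : ℤ) : ℝ)| / N < ρ) →
        (∀ n, ψ n ≠ 0 → (N : ℤ) < n ∧ n ≤ 2 * N) →
        (∀ n n' : ℤ, |ψ n - ψ n'| ≤
          (⨆ i : Fin k, ‖((((n - n' : ℤ) : ℝ) * α i : ℝ) : AddCircle (1 : ℝ))‖) +
            |((n - n' : ℤ) : ℝ)| / N) →
      ∀ (η : ℝ), cη * (Real.log N ^ aη)⁻¹ ≤ η → η ≤ 1 →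
      ∀ (u K w' : ℕ), N < (u + 1) ^ 4 → u ≤ K → K * u ≤ 2 * N → w' ∈ Icc 1 (2 * N / K) →
        η * ((2 * N / K : ℕ) : ℝ) - 1 ≤ #((Icc 1 (2 * N / K)).filter fun w => w ≠ w' ∧
          η * K ≤ ‖∑ d ∈ Ioc K (min (2 * K) (min (2 * N / w) (2 * N / w'))),
            ((ψ ((d * w : ℕ) : ℤ) : ℝ) : ℂ) * (AddCircle.toCircle (φ ((d * w : ℕ) : ℤ)) : ℂ) *
              conj (((ψ ((d * w' : ℕ) : ℤ) : ℝ) : ℂ) *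
                (AddCircle.toCircle (φ ((d * w' : ℕ) : ℤ)) : ℂ))‖) →
      ∀ ρ₁ : ℝ, ρ₁ = ((Real.log N ^ A₀) ^ ((k + 2) * (4 + 4 ^ (k + 2))))⁻¹ →
        ∃ (D : ℕ) (𝒟 : Finset ℕ), 1 ≤ D ∧ 𝒟 ⊆ Icc 1 D ∧
          4 * (32 * 38 ^ k) * (D : ℝ) ≤ (ρ₁ / 16) ^ (k + 1) * N / 2 ∧
          ρ₁ * (D : ℝ) ^ 2 / Real.log N ^ A₀ ≤ (#𝒟 : ℝ) ^ 2 ∧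
          ∀ d ∈ 𝒟, ∀ n ∈ (Finset.Ioo (-(N : ℤ)) N).filter fun n : ℤ =>
              (∀ i, ‖(((n : ℝ) * α i : ℝ) : AddCircle (1 : ℝ))‖ + |(n : ℝ)| / N < ρ₁) ∧
                |(n : ℝ)| / N < ρ₁,
            (d : ℤ) ∣ n → ∃ q : ℕ, 1 ≤ q ∧ (q : ℝ) ≤ Real.log N ^ A₀ ∧
              ‖((q : ℤ)) • (φ (n₀ + n + n) - φ (n₀ + n) - φ (n₀ + n) + φ n₀)‖ ≤
                Real.log N ^ A₀ * ρ₁ ^ 2) :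
    ∀ A : ℝ, 0 < A → ∀ A₁ : ℝ, ∃ A₀ : ℝ, A₁ ≤ A₀ ∧ ∃ N₀ : ℕ, ∀ N : ℕ, N₀ ≤ N → 2 ≤ N →
      ∀ (α : Fin k → ℝ) (n₀ : ℤ) (ρ : ℝ),
      0 < ρ → 100000 * ρ < 1 → (6 * Real.log N ^ A)⁻¹ ≤ ρ →
      (∀ n : ℤ, ((∀ i, ‖((((n - n₀ : ℤ) : ℝ) * α i : ℝ) : AddCircle (1 : ℝ))‖ +
          |((n - n₀ : ℤ) : ℝ)| / N < 100 * ρ) ∧ |((n - n₀ : ℤ) : ℝ)| / N < 100 * ρ) →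
        (N : ℤ) < n ∧ n ≤ 2 * N) →
      ∀ φ : ℤ → ℝ,
        (∀ n h₁ h₂ h₃ : ℤ,
          (∀ e₁ e₂ e₃ : ℕ, e₁ ≤ 1 → e₂ ≤ 1 → e₃ ≤ 1 →
            (∀ i, ‖((((n + e₁ * h₁ + e₂ * h₂ + e₃ * h₃ - n₀ : ℤ) : ℝ) * α i : ℝ) :
                AddCircle (1 : ℝ))‖ +
              |((n + e₁ * h₁ + e₂ * h₂ + e₃ * h₃ - n₀ : ℤ) : ℝ)| / N < 100 * ρ) ∧
            |((n + e₁ * h₁ + e₂ * h₂ + e₃ * h₃ - n₀ : ℤ) : ℝ)| / N < 100 * ρ) →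
          ∃ z : ℤ, φ (n + h₁ + h₂ + h₃) - φ (n + h₁ + h₂) - φ (n + h₁ + h₃) - φ (n + h₂ + h₃)
            + φ (n + h₁) + φ (n + h₂) + φ (n + h₃) - φ n = z) →
        ∀ ψ : ℤ → ℝ, (∀ n, 0 ≤ ψ n) →
          (∀ n, ψ n ≠ 0 →
            (∀ i, ‖((((n - n₀ : ℤ) : ℝ) * α i : ℝ) : AddCircle (1 : ℝ))‖ +
                |((n - n₀ : ℤ) : ℝ)| / N < ρ) ∧ |((n - n₀ : ℤ) : ℝ)| / N < ρ) →
          (∀ (n n' : ℤ) (t : ℝ), 0 ≤ t →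
            (∀ i, ‖((((n - n' : ℤ) : ℝ) * α i : ℝ) : AddCircle (1 : ℝ))‖ ≤ t) →
              |ψ n - ψ n'| ≤ t + |((n - n' : ℤ) : ℝ)| / N) →
          (N : ℝ) / Real.log N ^ A ≤
            ‖∑ n ∈ Ioc N (2 * N), ((μ n : ℝ) : ℂ) * ((ψ n : ℝ) : ℂ) * (𝐞 (-(φ n)) : ℂ)‖ →
          ∀ ρ₁ : ℝ, ρ₁ = ((Real.log N ^ A₀) ^ ((k + 2) * (4 + 4 ^ (k + 2))))⁻¹ →
            ∃ (D : ℕ) (𝒟 : Finset ℕ), 1 ≤ D ∧ 𝒟 ⊆ Icc 1 D ∧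
              4 * (32 * 38 ^ k) * (D : ℝ) ≤ (ρ₁ / 16) ^ (k + 1) * N / 2 ∧
              ρ₁ * (D : ℝ) ^ 2 / Real.log N ^ A₀ ≤ (#𝒟 : ℝ) ^ 2 ∧
              ∀ d ∈ 𝒟, ∀ n ∈ (Finset.Ioo (-(N : ℤ)) N).filter fun n : ℤ =>
                  (∀ i, ‖(((n : ℝ) * α i : ℝ) : AddCircle (1 : ℝ))‖ + |(n : ℝ)| / N < ρ₁) ∧
                    |(n : ℝ)| / N < ρ₁,
                (d : ℤ) ∣ n → ∃ q : ℕ, 1 ≤ q ∧ (q : ℝ) ≤ Real.log N ^ A₀ ∧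
                  ‖((q : ℤ)) • ((((φ (n₀ + n + n) : ℝ) : UnitAddCircle)) -
                    ((φ (n₀ + n) : ℝ) : UnitAddCircle) - ((φ (n₀ + n) : ℝ) : UnitAddCircle) +
                    ((φ n₀ : ℝ) : UnitAddCircle))‖ ≤ Real.log N ^ A₀ * ρ₁ ^ 2 := by
  intro A hA A₁
  obtain ⟨AI, hAI⟩ := hI (2 * A + 5) (1 / 10 ^ 8) (by linarith) (by norm_num)
  obtain ⟨AII, hAII⟩ := hII (2 * A + 5) (1 / 10 ^ 8) (by linarith) (by norm_num)
  obtain ⟨NI, hNI⟩ := hAI (max A₁ (max AI AII)) ((le_max_left _ _).trans (le_max_right _ _))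
  obtain ⟨NII, hNII⟩ := hAII (max A₁ (max AI AII)) ((le_max_right _ _).trans (le_max_right _ _))
  obtain ⟨N₁, hN₁⟩ := dichotomy_thresholds A hA
  refine ⟨max A₁ (max AI AII), le_max_left _ _, max N₁ (max NI NII), ?_⟩
  intro N hN h2N α n₀ ρ hρ hρ1 hρA hball φ hφ ψ hψ0 hsupp hlip hlarge
  have hN₁N : N₁ ≤ N := (le_max_left _ _).trans hN
  have hNIN : NI ≤ N := (le_max_left _ _).trans ((le_max_right _ _).trans hN)
  have hNIIN : NII ≤ N := (le_max_right _ _).trans ((le_max_right _ _).trans hN)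
  obtain ⟨hlog2, h8Lu, hρa, hη2, hthrI, hthrII⟩ := hN₁ N hN₁N
  have hN1 : 1 ≤ N := by omega
  have hNr : (0 : ℝ) < N := by exact_mod_cast (show 0 < N by omega)
  have hlogpos : 0 < Real.log N := by linarith
  have hLA : 0 < Real.log N ^ A := Real.rpow_pos_of_pos hlogpos A
  have hρa' : (Real.log N ^ (2 * A + 5))⁻¹ ≤ ρ := hρa.trans hρA
  set η : ℝ := 1 / 10 ^ 8 * (Real.log N ^ (2 * A + 5))⁻¹ with hη
  have hηpos : 0 < η := by rw [hη]; positivity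
  have hηc : 1 / 10 ^ 8 * (Real.log N ^ (2 * A + 5))⁻¹ ≤ η := le_rfl
  have hη1 : η ≤ 1 := by linarith
  -- `u = ⌊√⌊√N⌋⌋`
  set u : ℕ := Nat.sqrt (Nat.sqrt N) with hu
  have hu1 : 1 ≤ u := by
    rw [hu, Nat.le_sqrt, Nat.le_sqrt]; simpa using hN1
  have huuS : u * u ≤ Nat.sqrt N := Nat.sqrt_le (Nat.sqrt N)
  have hUU : (u * u) * (u * u) ≤ N := (Nat.mul_le_mul huuS huuS).trans (Nat.sqrt_le N)
  have huu : u * u ≤ 2 * N := by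
    have := huuS.trans (Nat.sqrt_le_self N); omega
  have hu4 : N < (u + 1) ^ 4 := by
    have h1 : Nat.sqrt N < (u + 1) * (u + 1) := Nat.lt_succ_sqrt (Nat.sqrt N)
    have h2 : N < (Nat.sqrt N + 1) * (Nat.sqrt N + 1) := Nat.lt_succ_sqrt N
    have h3 : Nat.sqrt N + 1 ≤ (u + 1) * (u + 1) := h1
    calc N < (Nat.sqrt N + 1) * (Nat.sqrt N + 1) := h2
      _ ≤ ((u + 1) * (u + 1)) * ((u + 1) * (u + 1)) := Nat.mul_le_mul h3 h3
      _ = (u + 1) ^ 4 := by ring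
  -- the rescaled weight and the lifted phase
  have hψ32 : ∀ n, ψ n ≤ 3 / 2 :=
    weight_le_three_halves α hN1 n₀ (by linarith) ψ hψ0 hsupp hlip
  set ψ₂ : ℤ → ℝ := fun n => ψ n / 2 with hψ₂
  set φ' : ℤ → UnitAddCircle := fun n => ((φ n : ℝ) : UnitAddCircle) with hφ'
  have hψ₂0 : ∀ n, 0 ≤ ψ₂ n := fun n => by simp only [hψ₂]; linarith [hψ0 n]
  have hψ₂1 : ∀ n, ψ₂ n ≤ 1 := fun n => by simp only [hψ₂]; linarith [hψ32 n]
  have hψ₂ne : ∀ n, ψ₂ n ≠ 0 → ψ n ≠ 0 := fun n h h0 => h (by simp only [hψ₂, h0, zero_div])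
  have hsuppN : ∀ n, ψ₂ n ≠ 0 → (N : ℤ) < n ∧ n ≤ 2 * N := by
    intro n hn
    have h := hsupp n (hψ₂ne n hn)
    refine hball n ⟨fun i => ?_, ?_⟩
    · have := h.1 i; linarith
    · linarith [h.2]
  have hsuppν : ∀ n, ψ₂ n ≠ 0 →
      (⨆ i : Fin k, ‖((((n - n₀ : ℤ) : ℝ) * α i : ℝ) : AddCircle (1 : ℝ))‖) +
        |((n - n₀ : ℤ) : ℝ)| / N < ρ := by
    intro n hn
    exact (bohrGauge_lt_iff α N (n - n₀) ρ).2 (hsupp n (hψ₂ne n hn))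
  have hlipν : ∀ n n' : ℤ, |ψ₂ n - ψ₂ n'| ≤
      (⨆ i : Fin k, ‖((((n - n' : ℤ) : ℝ) * α i : ℝ) : AddCircle (1 : ℝ))‖) +
        |((n - n' : ℤ) : ℝ)| / N := by
    intro n n'
    have h := hlip n n' (⨆ i : Fin k, ‖((((n - n' : ℤ) : ℝ) * α i : ℝ) : AddCircle (1 : ℝ))‖)
      (iSup_norm_nonneg α _) (fun i => le_ciSup (bddAbove_range_norm α (n - n')) i)
    have e : ψ₂ n - ψ₂ n' = (ψ n - ψ n') / 2 := by simp only [hψ₂]; ring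
    rw [e, abs_div, abs_two]
    have := abs_nonneg (ψ n - ψ n')
    have h0 : 0 ≤ (⨆ i : Fin k, ‖((((n - n' : ℤ) : ℝ) * α i : ℝ) : AddCircle (1 : ℝ))‖) +
        |((n - n' : ℤ) : ℝ)| / N := by have := iSup_norm_nonneg α (n - n'); positivity
    linarith
  have hφ'cube := cube_vanish_of_integral α N n₀ (100 * ρ) φ hφ
  -- the summand `F = ψ₂ e(φ)` and the dichotomy
  set F : ℕ → ℂ := fun n => ((ψ₂ n : ℝ) : ℂ) * (AddCircle.toCircle (φ' n) : ℂ) with hF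
  have hF1 : ∀ n, ‖F n‖ ≤ 1 := by
    intro n
    simp only [hF, norm_mul, Circle.norm_coe, mul_one, Complex.norm_real, Real.norm_eq_abs,
      abs_of_nonneg (hψ₂0 n)]
    exact hψ₂1 n
  have hF0 : ∀ n, n ≤ N → F n = 0 := by
    intro n hn
    have : ψ₂ n = 0 := by
      by_contra h
      have := (hsuppN n h).1
      omega
    simp only [hF, this, Complex.ofReal_zero, zero_mul]
  have hsumF : ‖∑ n ∈ Ioc N (2 * N), ((μ n : ℝ) : ℂ) * F n‖ =
      1 / 2 * ‖∑ n ∈ Ioc N (2 * N), ((μ n : ℝ) : ℂ) * ((ψ n : ℝ) : ℂ) * (𝐞 (-(φ n)) : ℂ)‖ := by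
    simp only [hF, hψ₂, hφ']
    exact norm_sum_half_weight ψ φ (Ioc N (2 * N))
  have hX0 : (0 : ℝ) ≤ (N : ℝ) / (8 * Real.log N ^ A) := by positivity
  have hlargeF : 2 * (u : ℝ) + 2 * ((N : ℝ) / (8 * Real.log N ^ A)) ≤
      ‖∑ n ∈ Ioc N (2 * N), ((μ n : ℝ) : ℂ) * F n‖ := by
    rw [hsumF]
    have h1 : (N : ℝ) / Real.log N ^ A * (1 / 2) ≤
        1 / 2 * ‖∑ n ∈ Ioc N (2 * N), ((μ n : ℝ) : ℂ) * ((ψ n : ℝ) : ℂ) * (𝐞 (-(φ n)) : ℂ)‖ := by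
      nlinarith [hlarge, norm_nonneg (∑ n ∈ Ioc N (2 * N),
        ((μ n : ℝ) : ℂ) * ((ψ n : ℝ) : ℂ) * (𝐞 (-(φ n)) : ℂ))]
    refine le_trans ?_ h1
    have h2 : 2 * (u : ℝ) ≤ (N : ℝ) / (4 * Real.log N ^ A) := by
      rw [le_div_iff₀ (by positivity)]; linarith
    have e : (N : ℝ) / Real.log N ^ A * (1 / 2) =
        (N : ℝ) / (4 * Real.log N ^ A) + 2 * ((N : ℝ) / (8 * Real.log N ^ A)) := by
      field_simp; ring
    rw [e]; linarith
  have hdich := dichotomy hN1 hu1 huu F hF1 hF0 hX0 hηpos hηpos hlargeF hthrI hthrII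
  -- dispatch
  intro ρ₁ hρ₁
  rcases hdich with ⟨j, -, hgood⟩ | ⟨K, huK, hKu, w', hw', hgood⟩
  · exact hNI N hNIN h2N α n₀ ρ hρ hρ1 hρa' φ' hφ'cube ψ₂ hψ₂0 hψ₂1 hsuppν hsuppN hlipν η hηc
      hη2 (u * u) j hUU hgood ρ₁ hρ₁
  · exact hNII N hNIIN h2N α n₀ ρ hρ hρ1 hρa' φ' hφ'cube ψ₂ hψ₂0 hψ₂1 hsuppν hsuppN hlipν η hηc
      hη1 u K w' hu4 huK hKu hw' hgood ρ₁ hρ₁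

end Summit.Parity.GeneralizedHardyLittlewood.GreenTaoLevelTwoMNTwoPropTwentyTwoBudget
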